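/-
Copyright (c) 2026 the pub-hodgecm-mathlib formalisation cell (harness21).  Prover seat hodgecm-mathlib-F0P2-p02 (g13): road «S3-ram» (LEAD F0P3a-plan (g12); architect
A-p16 (g31); owner F0P3a-p06 (g15)), organ J1 «DIAGONAL-MODEL TREE» of F0P3a-p01 (g16)'s JUNCTION PLAN (J-PACK, 2026-09-01T23:57Z); 2026-09-02.
-/
import Literature.NumberTheory.Automorphic.UnitaryLatticeTreeFramesOfInvolution        -- ★ `isTree_latticeGraph_three_of_neg` (the antidiagonal model is a tree)
import Literature.NumberTheory.Automorphic.UnitaryLatticeTreeFormTransport             -- ★ p847249 (F0P3a-p01 (g16)): `exists_iso_latticeGraph_smul_form`, `isTree_latticeGraph_formCongr_iff`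
import Literature.NumberTheory.Automorphic.UnitaryLatticeTreeUnimodularFrame            -- ★ `exists_glInt_eq_smul_formCongr_antidiagonal_of_isotropic` (the frame from an isotropic vector)
import Literature.NumberTheory.Automorphic.UnitaryThreeBoundaryRigidityLevelTwoRamified  -- ★ `UnitaryGroup.residue_two_ne_zero_of_v_two_eq_one`; brings ★ `residue_eq_zero_iff_v_lt_one`
import Mathlib.FieldTheory.Finite.Basic                                                  -- `FiniteField.exists_root_sum_quadratic` (Chevalley's theorem for ternary diagonal forms)
import HarnessLib

/-!
# The lattice graph of a DIAGONAL unimodular hermitian form in three variables at a tamely ramified place is a TREE (Bruhat–Tits 1972 §10; Tits 1979 §2.4; Serre, *Trees* II.1.1)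

Topic `NumberTheory/Automorphic`; namespace `Literature.NumberTheory.Automorphic.UnitaryLatticeTree`.  THEOREMS ONLY (no definition, no instance, no notation, no named fact,
no `sorry`); kernel lane `--supports stmt-HodgeConjecture-24833`; datum-free (`K` with `Valued K ℤᵐ⁰`, finite residue field, `σ` an isometric involution with `σϖ = −ϖ`,
residually trivial, `|2| = 1`, first-order norm surjectivity `hnorm` — the binders of ★ `isTree_latticeGraph_three_of_neg`).  Cell `pub/hodgecm-mathlib`, crux H413 =
`stmt-HodgeConjecture-24833`; road «S3-ram» (count-neutral): organ **J1 «DIAGONAL-MODEL TREE»** of F0P3a-p01 (g16)'s junction plan for the (a2) tree induction (the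
engine ★ `DepthZeroKappaTransferTypeOneRamifiedTreeInduction` runs on `latticeGraph σ ϖ (diag d)`, the eigenframe model of a type-(1) literal, and wants `IsTree` there).
Seat F0P2-p02 (g13).  HONEST LABEL: HC_CM is proved only modulo the cell's 2 remaining named inputs (hLiu418 24832, h413 24833) until rung 0 closes; nothing printed is
asserted here (elementary valuation algebra + Chevalley's theorem + the ★ tree theorem).

THE MATHEMATICS.  `d : Fin 3 → K` units with `σ dᵢ = dᵢ`; `H = diag d` is `σ`-hermitian, integral, `|det H| = 1`.  (§1) Over the finite residue field of odd characteristic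
the ternary diagonal form `Σ d̄ᵢ Xᵢ²` has a zero with `X₂ = 1` (`FiniteField.exists_root_sum_quadratic` applied to `d̄₀X²` and `d̄₁X² + d̄₂`); any lift `x = (a, b, 1) ∈ 𝒪³`
is PRIMITIVE and RESIDUALLY ISOTROPIC: `|Σ σ(xᵢ) dᵢ xᵢ| < 1` (`σ` is the identity on the residue field).  (§2) Hence ★ `exists_glInt_eq_smul_formCongr_antidiagonal_of_isotropic`
writes `diag d = (−det) • ᵗσ(A) J₀ A` with `A ∈ GL₃(𝒪)`, and the lattice graph of `diag d` is isomorphic to that of `J₀` (★ p847249: unit rescaling + change of frame), which is a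
tree by ★ `isTree_latticeGraph_three_of_neg`.
* §1 `ringChar_residueField_ne_two`, `exists_v_diagonal_ternary_lt_one` (a residual zero of `d₀a² + d₁b² + d₂`), `v_pairing_diagonal_self_lt_one`
  (`x = (a, b, 1)` is residually isotropic for `pairing σ (diag d)`), `vecCons_mem_stdLattice_three`.
* §2 `transpose_map_diagonal_of_fixed`, `isIntMatrix_diagonal_of_v_eq_one`, `v_det_diagonal_of_v_eq_one`, `isTree_latticeGraph_congr` (transport along an equality of forms),
  **`exists_glInt_diagonal_eq_smul_formCongr_antidiagonal`** (the frame), **`isTree_latticeGraph_three_diagonal_of_neg`** (THE HEAD).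

## References
* [BruhatTits1972] F. Bruhat, J. Tits, *Groupes réductifs sur un corps local I*, Publ. Math. IHÉS 41 (1972), §10 (the building of a rank-one group is a tree).
* [Tits1979] J. Tits, *Reductive groups over local fields*, PSPM 33.1 (1979), §2.4 (ramified quasi-split `U(3)`), §3.5.
* [Serre1980Trees] J.-P. Serre, *Trees* (1980), Ch. II §1.1.
* [Jacobowitz1962] R. Jacobowitz, *Hermitian forms over local fields*, Amer. J. Math. 84 (1962), §3 Thm. 3.1, §8 (unimodular hermitian lattices; isotropic vectors).
* [Serre1973] J.-P. Serre, *A Course in Arithmetic* (1973), Ch. I §2 Thm. 3 (Chevalley–Warning: a ternary quadratic form over a finite field represents zero).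
-/

set_option autoImplicit false

noncomputable section

open scoped Valued WithZero Matrix MatrixGroups
open Matrix

namespace Literature.NumberTheory.Automorphic.UnitaryLatticeTree

open Literature.NumberTheory.Automorphic Literature.NumberTheory.Automorphic.HermitianLattice

variable {K : Type*} [Field K] [Valued K ℤᵐ⁰] {σ : K →+* K} {ϖ : K}

/-! ## §1 A residually isotropic primitive vector for a diagonal ternary unit form -/

/-- `|2| = 1` ⇒ the residue field has characteristic `≠ 2` (★ `UnitaryGroup.residue_two_ne_zero_of_v_two_eq_one`: `2 ≠ 0` there). [cite: Serre1973, Ch. I §2 Thm. 3] -/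
theorem ringChar_residueField_ne_two (h2 : Valued.v (2 : K) = 1) : ringChar 𝓀[K] ≠ 2 := by
  intro hc
  apply UnitaryGroup.residue_two_ne_zero_of_v_two_eq_one h2
  have h := (ringChar.spec 𝓀[K] 2).2 (by rw [hc])
  exact_mod_cast h

/-- **A residual zero of the ternary diagonal form with last coordinate `1`** (Chevalley's theorem in the form `FiniteField.exists_root_sum_quadratic`, odd residue
characteristic): for units `d₀ d₁ d₂` there are `a, b ∈ 𝒪` with `|d₀a² + d₁b² + d₂| < 1`. [cite: Serre1973, Ch. I §2 Thm. 3] [cite: Jacobowitz1962, §8] -/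
theorem exists_v_diagonal_ternary_lt_one [Finite 𝓀[K]] (h2 : Valued.v (2 : K) = 1) (d : Fin 3 → K) (hd : ∀ i, Valued.v (d i) = 1) :
    ∃ a b : K, Valued.v a ≤ 1 ∧ Valued.v b ≤ 1 ∧ Valued.v (d 0 * a ^ 2 + d 1 * b ^ 2 + d 2) < 1 := by
  classical
  haveI : Fintype 𝓀[K] := Fintype.ofFinite _
  -- the units `dᵢ` as elements of `𝒪` and their (non-zero) residues
  set e : Fin 3 → 𝒪[K] := fun i => ⟨d i, (hd i).le⟩ with he
  set δ : Fin 3 → 𝓀[K] := fun i => IsLocalRing.residue 𝒪[K] (e i) with hδ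
  have hδ0 : ∀ i, δ i ≠ 0 := fun i h => by
    rw [hδ, residue_eq_zero_iff_v_lt_one] at h
    have h' : Valued.v (d i) < 1 := h
    rw [hd i] at h'
    exact lt_irrefl 1 h'
  -- Chevalley: `δ₀ a₀² + (δ₁ b₀² + δ₂) = 0` has a solution
  have hf2 : (Polynomial.C (δ 0) * Polynomial.X ^ 2).degree = 2 := by
    rw [Polynomial.degree_C_mul_X_pow 2 (hδ0 0)]
    rfl
  have hg2 : (Polynomial.C (δ 1) * Polynomial.X ^ 2 + Polynomial.C (δ 2)).degree = 2 := by
    rw [Polynomial.degree_add_C (by rw [Polynomial.degree_C_mul_X_pow 2 (hδ0 1)]; exact WithBot.coe_lt_coe.2 (by norm_num)),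
      Polynomial.degree_C_mul_X_pow 2 (hδ0 1)]
    rfl
  obtain ⟨a₀, b₀, hab⟩ := FiniteField.exists_root_sum_quadratic hf2 hg2 (FiniteField.odd_card_of_char_ne_two (ringChar_residueField_ne_two h2))
  simp only [Polynomial.eval_mul, Polynomial.eval_C, Polynomial.eval_pow, Polynomial.eval_X, Polynomial.eval_add] at hab
  -- lift the residual solution
  obtain ⟨a, rfl⟩ := IsLocalRing.residue_surjective a₀
  obtain ⟨b, rfl⟩ := IsLocalRing.residue_surjective b₀
  refine ⟨a, b, a.2, b.2, ?_⟩
  have hres0 : IsLocalRing.residue 𝒪[K] (e 0 * a ^ 2 + (e 1 * b ^ 2 + e 2)) = 0 := by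
    simp only [map_add, map_mul, map_pow]
    exact hab
  have hlt := (residue_eq_zero_iff_v_lt_one _).1 hres0
  have hcoe : ((e 0 * a ^ 2 + (e 1 * b ^ 2 + e 2) : 𝒪[K]) : K) = d 0 * (a : K) ^ 2 + d 1 * (b : K) ^ 2 + d 2 := by
    push_cast
    rw [he]
    ring
  rw [hcoe] at hlt
  exact hlt

/-- **`x = (a, b, 1)` is residually isotropic for `pairing σ (diag d)`**: `|σ(a)d₀a + σ(b)d₁b + d₂| < 1` when `|d₀a² + d₁b² + d₂| < 1` (`σ` preserves `v` and is the identity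
on the residue field: `|σy − y| < 1` for `|y| ≤ 1`; `σ` need not preserve `v` here). [cite: Jacobowitz1962, §8] -/
theorem v_pairing_diagonal_self_lt_one (hres : ∀ x : K, Valued.v x ≤ 1 → Valued.v (σ x - x) < 1)
    (d : Fin 3 → K) (hd : ∀ i, Valued.v (d i) = 1) {a b : K} (ha : Valued.v a ≤ 1) (hb : Valued.v b ≤ 1)
    (h : Valued.v (d 0 * a ^ 2 + d 1 * b ^ 2 + d 2) < 1) :
    Valued.v (pairing σ (Matrix.diagonal d) ![a, b, 1] ![a, b, 1]) < 1 := by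
  have hp : pairing σ (Matrix.diagonal d) ![a, b, 1] ![a, b, 1] = σ a * d 0 * a + σ b * d 1 * b + d 2 := by
    simp [pairing_apply, Fin.sum_univ_three, Matrix.diagonal_apply_ne, Matrix.diagonal_apply_eq]
  rw [hp]
  have hsplit : σ a * d 0 * a + σ b * d 1 * b + d 2 = ((σ a - a) * (d 0 * a) + (σ b - b) * (d 1 * b)) + (d 0 * a ^ 2 + d 1 * b ^ 2 + d 2) := by ring
  rw [hsplit]
  refine Valuation.map_add_lt _ (Valuation.map_add_lt _ ?_ ?_) h
  · rw [map_mul, map_mul, hd 0, one_mul]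
    exact mul_lt_one_of_lt_of_le (hres a ha) ha
  · rw [map_mul, map_mul, hd 1, one_mul]
    exact mul_lt_one_of_lt_of_le (hres b hb) hb

/-- `(a, b, 1) ∈ 𝒪³` for `a, b ∈ 𝒪`. [cite: Serre1980Trees, II.1.1] -/
theorem vecCons_mem_stdLattice_three {a b : K} (ha : Valued.v a ≤ 1) (hb : Valued.v b ≤ 1) : (![a, b, 1] : Fin 3 → K) ∈ stdLattice K 3 := by
  intro k
  fin_cases k
  · simpa using ha
  · simpa using hb
  · simp

/-! ## §2 The frame and the tree -/

omit [Valued K ℤᵐ⁰] in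
/-- A diagonal matrix with `σ`-fixed entries is `σ`-hermitian: `(σ (diag d))ᵀ = diag d`. [cite: Jacobowitz1962, §3 Thm. 3.1] -/
theorem transpose_map_diagonal_of_fixed (d : Fin 3 → K) (hdσ : ∀ i, σ (d i) = d i) : ((Matrix.diagonal d).map σ)ᵀ = Matrix.diagonal d := by
  rw [Matrix.diagonal_map (map_zero σ), Matrix.diagonal_transpose]
  congr 1
  funext i
  exact hdσ i

/-- A diagonal matrix with unit entries is integral. [cite: Jacobowitz1962, §8] -/
theorem isIntMatrix_diagonal_of_v_eq_one (d : Fin 3 → K) (hd : ∀ i, Valued.v (d i) = 1) : IsIntMatrix (Matrix.diagonal d) := by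
  intro i j
  by_cases h : i = j
  · subst h
    rw [Matrix.diagonal_apply_eq]
    exact (hd i).le
  · rw [Matrix.diagonal_apply_ne _ h, map_zero]
    exact zero_le_one

/-- `|det (diag d)| = 1` for unit entries. [cite: Jacobowitz1962, §8] -/
theorem v_det_diagonal_of_v_eq_one (d : Fin 3 → K) (hd : ∀ i, Valued.v (d i) = 1) : Valued.v (Matrix.diagonal d).det = 1 := by
  rw [Matrix.det_diagonal, map_prod]
  exact Finset.prod_eq_one fun i _ => hd i

/-- The tree property transports along an equality of forms (the vertex type depends on the form, so this is stated as a lemma rather than a `rw`). [cite: BruhatTits1972, §10] -/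
theorem isTree_latticeGraph_congr {N : ℕ} {H H' : Matrix (Fin N) (Fin N) K} (h : H = H') (hT : (latticeGraph σ ϖ H').IsTree) : (latticeGraph σ ϖ H).IsTree := by
  subst h
  exact hT

/-- **THE FRAME OF A DIAGONAL UNIT FORM AT A TAMELY RAMIFIED PLACE**: `diag d = (−det (diag d)) • ᵗσ(A) J₀ A` with `A, A⁻¹ ∈ M₃(𝒪)` (★ `exists_glInt_eq_smul_formCongr_antidiagonal_of_isotropic`
fed with the residually isotropic primitive vector of §1; `htrace` is witnessed by `t = 1∕2`). [cite: Jacobowitz1962, §3 Thm. 3.1, §8] [cite: BruhatTits1972, §10] -/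
theorem exists_glInt_diagonal_eq_smul_formCongr_antidiagonal [Finite 𝓀[K]] (hσ : ∀ x, σ (σ x) = x) (hvσ : ∀ a, Valued.v (σ a) = Valued.v a)
    (hres : ∀ x : K, Valued.v x ≤ 1 → Valued.v (σ x - x) < 1) (h2 : Valued.v (2 : K) = 1)
    (hnorm : ∀ u : K, σ u = u → Valued.v (u - 1) < 1 → ∃ z : K, z * σ z = u ∧ Valued.v (z - 1) ≤ Valued.v (u - 1))
    (d : Fin 3 → K) (hd : ∀ i, Valued.v (d i) = 1) (hdσ : ∀ i, σ (d i) = d i) :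
    ∃ A : GL (Fin 3) K, IsIntMatrix (A : Matrix (Fin 3) (Fin 3) K) ∧ IsIntMatrix ((A⁻¹ : GL (Fin 3) K) : Matrix (Fin 3) (Fin 3) K) ∧
      Matrix.diagonal d = (-(Matrix.diagonal d).det) • formCongr σ A ((StdForm.antidiagonal 3).over K) := by
  obtain ⟨a, b, ha, hb, hlt⟩ := exists_v_diagonal_ternary_lt_one h2 d hd
  have h20 : (2 : K) ≠ 0 := fun h => by rw [h, map_zero] at h2; exact zero_ne_one h2
  have htrace : ∃ t : K, Valued.v t ≤ 1 ∧ t + σ t = 1 :=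
    ⟨2⁻¹, by rw [Valuation.map_inv, h2, inv_one], by rw [map_inv₀ σ (2 : K), map_ofNat σ 2, ← two_mul, mul_inv_cancel₀ h20]⟩
  exact exists_glInt_eq_smul_formCongr_antidiagonal_of_isotropic hσ hvσ htrace hnorm (transpose_map_diagonal_of_fixed d hdσ)
    (isIntMatrix_diagonal_of_v_eq_one d hd) (v_det_diagonal_of_v_eq_one d hd) (vecCons_mem_stdLattice_three ha hb) (i := 2) (by simp)
    (v_pairing_diagonal_self_lt_one hres d hd ha hb hlt)

/-- **THE LATTICE GRAPH OF A DIAGONAL UNIT FORM `diag d` (`σ dᵢ = dᵢ`, `|dᵢ| = 1`) AT A TAMELY RAMIFIED PLACE IS A TREE** — the eigenframe model of a type-(1) literal; binders =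
those of ★ `isTree_latticeGraph_three_of_neg` (incl. its `[ValuativeRel K] [Valued.v.Compatible]` currency) + a finite residue field. [cite: BruhatTits1972, §10] [cite: Tits1979, §2.4] [cite: Serre1980Trees, II.1.1] -/
theorem isTree_latticeGraph_three_diagonal_of_neg [ValuativeRel K] [(Valued.v : Valuation K ℤᵐ⁰).Compatible] [Finite 𝓀[K]] (hσ : ∀ x, σ (σ x) = x) (hvσ : ∀ a, Valued.v (σ a) = Valued.v a)
    (hϖ : Valued.v ϖ = WithZero.exp (-1 : ℤ)) (hσϖ : σ ϖ = -ϖ) (hres : ∀ x : K, Valued.v x ≤ 1 → Valued.v (σ x - x) < 1) (h2 : Valued.v (2 : K) = 1)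
    (hnorm : ∀ u : K, σ u = u → Valued.v (u - 1) < 1 → ∃ z : K, z * σ z = u ∧ Valued.v (z - 1) ≤ Valued.v (u - 1))
    (d : Fin 3 → K) (hd : ∀ i, Valued.v (d i) = 1) (hdσ : ∀ i, σ (d i) = d i) :
    (latticeGraph σ ϖ (Matrix.diagonal d)).IsTree := by
  obtain ⟨A, -, -, hA⟩ := exists_glInt_diagonal_eq_smul_formCongr_antidiagonal hσ hvσ hres h2 hnorm d hd hdσ
  have hc : Valued.v (-(Matrix.diagonal d).det) = 1 := by rw [Valuation.map_neg, v_det_diagonal_of_v_eq_one d hd]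
  refine isTree_latticeGraph_congr hA ?_
  obtain ⟨φ, -⟩ := exists_iso_latticeGraph_smul_form σ ϖ hc (formCongr σ A ((StdForm.antidiagonal 3).over K))
  rw [φ.isTree_iff, isTree_latticeGraph_formCongr_iff]
  exact isTree_latticeGraph_three_of_neg hσ hvσ hϖ hσϖ hres h2 hnorm

end Literature.NumberTheory.Automorphic.UnitaryLatticeTree
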